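import Summits.BirchSwinnertonDyer.BirchSwinnertonDyer.Theorems.ManinLocalTwoThreeShiftClosureDescent
import HarnessLib

/-!
# LEMMA G (E-es-31, MEMO-es §23.1), part 2/2: the S-arithmetic closure — a shift-stable subgroup of `SL₂(ℤ[1/t])`
# containing `Γ₀(t^k L')` contains `Δ_t(L') = Γ₀(L'; ℤ[1/t])`

Summit `BirchSwinnertonDyer`, cruxes C3 `ManinPrimeToThreeAtNine` (stmt-BirchSwinnertonDyer-22968) / C2 `ManinOddAtFour`
(stmt-22967), route `ManinLocalTwoThree` (cell bsd-f2-manin): the registered stubs `stub_relativeIharaBar331` /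
`stub_relativeIharaBarTwo` are the leaf E-es-25 `RelativeIharaShiftVanishingBar p t n` (relative Ihara at a prime dividing
the level), whose fact-free proof plan (planner bsd-f2-manin-es g11, MEMO-es §23) has the elementary input LEMMA G:

  for a prime `t`, `n ≥ 1`, `L = t^k L'` with `t ∤ L'`, every subgroup `H ≤ SL₂(ℤ[1/t])` containing `ι Γ₀(L)` and
  stable under the shifts `g ↦ A^{±n} g A^{∓n}` (`A = diag(t,1)`; on entries `(α, β; γ, δ) ↦ (α, t^{±n}β; t^{∓n}γ, δ)`)
  contains `Δ_t(L') = {g ∈ SL₂(ℤ[1/t]) : γ ∈ L'ℤ[1/t]}` (cell bsd-f3-mu's `ConjSpanGenAllLevels.Delta t L'`).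

This file PROVES it (`delta_le_of_gamma0Image_le_of_shiftStable`; steps (i)–(ii) in the prequel
`…ShiftClosureDescent.lean`), in bsd-f3-mu's `SL₂(ℤ[1/t])` vocabulary (`Away`,
`iota`, `upperUnip`, `lowerUnip`, `diagP`, `negOne`, `upperB`, `Delta`, `gamma0Image`) and BY NAME through their theorem
`deltaEqGamma0MulUpper` (`Δ = ι Γ₀(L')·B⁺`, `t ∤ L'`).  The shift hypotheses are stated on ENTRIES (`g'₀₁ = t^n g₀₁`,
`t^n g'₁₀ = g₁₀`, diagonal unchanged — and the inverse shift), so that any typed form of the shift (the planner's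
`shiftConj t n` / `shiftConjInv t n`) instantiates them by `rfl`.  Steps (MEMO-es §23.1): (i) DESCENT — the generation lemma
`⟨Γ₀(M t^n), A^n Γ₀(M t^n) A^{-n}⟩ = Γ₀(M)` (`range_degeneracyConj_one_sup_range_degeneracyConj_pow_eq_top`, the prime-power
version of the lead's landed `…_eq_top`) iterated down the `t`-part of the level gives `ι Γ₀(L') ≤ H`; (ii) `U⁺(ℤ[1/t]) ≤ H`
and `U⁻(L'ℤ[1/t]) ≤ H` by un-shifting integral unipotents; (iii) `diag(t, 1/t) ∈ H` from the identity
`(1 0; −L'/t 1)·ι(t b; L' d)·(1 −b/t; 0 1) = diag(t, 1/t)` (`t d − b L' = 1`); (iv) `B⁺ ≤ H` (units of `ℤ[1/t]` are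
`±t^ℤ`); (v) `Δ_t(L') = ι Γ₀(L')·B⁺ ≤ H`.  Nothing about BSD or Manin's conjecture is proved here.
-/

set_option autoImplicit false
set_option linter.dupNamespace false

open scoped MatrixGroups

open CongruenceSubgroup Literature.NumberTheory.EllipticCurves.ModularForms
  Summit.BirchSwinnertonDyer.BirchSwinnertonDyer.Theorems.ConjSpanGenAllLevels

namespace Summit.BirchSwinnertonDyer.BirchSwinnertonDyer.Theorems.ManinLocalTwoThree

/-! ### (iii)–(v) `diag(t, 1/t)`, the Borel `B⁺`, and `Δ_t(L') = ι Γ₀(L') · B⁺` -/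

section Borel

variable {t : ℕ} (H : Subgroup SL(2, Away t))

/-- **`diag(t, 1/t) ∈ H`** from `U⁺(ℤ[1/t]), U⁻(L'ℤ[1/t]), ι Γ₀(L') ≤ H` and `gcd(t, L') = 1`:
`(1 0; −L'/t 1) · ι(t b; L' d) · (1 −b/t; 0 1) = diag(t, 1/t)` with `t d − b L' = 1` (MEMO-es §23.1 LEMMA G (iv)).
[folklore] -/
theorem diagP_mem_of_unipotents (htp : t.Prime) {L' : ℕ} (hL' : ¬ t ∣ L') (hΓ : gamma0Image t L' ≤ H)
    (hU : ∀ x : Away t, upperUnip x ∈ H) (hV : ∀ y : Away t, lowerUnip ((L' : Away t) * y) ∈ H) :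
    diagP t ∈ H := by
  -- Bézout: `t d - L' b = 1`
  obtain ⟨d, b, hdb⟩ : IsCoprime (t : ℤ) (L' : ℤ) :=
    Nat.isCoprime_iff_coprime.mpr ((Nat.Prime.coprime_iff_not_dvd htp).mpr hL')
  -- `γ₀ = (t, -b; L', d) ∈ Γ₀(L')`
  let γ₀ : SL(2, ℤ) := ⟨!![(t : ℤ), -b; (L' : ℤ), d], by rw [Matrix.det_fin_two_of]; linear_combination hdb⟩
  have hγ₀ : ConjSpanGenAllLevels.iota t γ₀ ∈ H :=
    hΓ ⟨γ₀, mem_Gamma0_of_dvd_apply_one_zero γ₀ (dvd_refl _), rfl⟩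
  set T : Away t := algebraMap ℤ (Away t) (t : ℤ) with hT
  set T' : Away t := IsLocalization.Away.invSelf (t : ℤ) with hT'
  have hTT' : T * T' = 1 := IsLocalization.Away.mul_invSelf (S := Away t) (t : ℤ)
  have hTt : T = (t : Away t) := by rw [hT, map_natCast]
  -- entries of the three factors
  have hdb' : (d : Away t) * T + (b : Away t) * (L' : Away t) = 1 := by
    have := congrArg (fun z : ℤ ↦ (z : Away t)) hdb
    push_cast at this
    rw [hTt]; linear_combination this
  set G := ConjSpanGenAllLevels.iota t γ₀ with hG
  have g00 : G 0 0 = T := by rw [hG, ConjSpanGenAllLevels.iota_apply, hTt]; simp [γ₀]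
  have g01 : G 0 1 = -(b : Away t) := by rw [hG, ConjSpanGenAllLevels.iota_apply]; simp [γ₀]
  have g10 : G 1 0 = (L' : Away t) := by rw [hG, ConjSpanGenAllLevels.iota_apply]; simp [γ₀]
  have g11 : G 1 1 = (d : Away t) := by rw [hG, ConjSpanGenAllLevels.iota_apply]; simp [γ₀]
  set v : Away t := (L' : Away t) * (-T') with hv
  set u : Away t := (b : Away t) * T' with hu
  have v00 : (lowerUnip v) 0 0 = 1 := by simp [lowerUnip]
  have v01 : (lowerUnip v) 0 1 = 0 := by simp [lowerUnip]
  have v10 : (lowerUnip v) 1 0 = v := by simp [lowerUnip]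
  have v11 : (lowerUnip v) 1 1 = 1 := by simp [lowerUnip]
  have u00 : (upperUnip u) 0 0 = 1 := by simp [upperUnip]
  have u01 : (upperUnip u) 0 1 = u := by simp [upperUnip]
  have u10 : (upperUnip u) 1 0 = 0 := by simp [upperUnip]
  have u11 : (upperUnip u) 1 1 = 1 := by simp [upperUnip]
  -- the identity, entrywise
  have key : diagP t = lowerUnip v * G * upperUnip u := by
    ext i j
    fin_cases i <;> fin_cases j
    · show T = (lowerUnip v * G * upperUnip u) 0 0
      rw [Literature.NumberTheory.Automorphic.SL2Rel.mul_apply_two,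
        Literature.NumberTheory.Automorphic.SL2Rel.mul_apply_two,
        Literature.NumberTheory.Automorphic.SL2Rel.mul_apply_two, v00, v01, g00, g10, g01, g11, u00, u10]
      ring
    · show (0 : Away t) = (lowerUnip v * G * upperUnip u) 0 1
      rw [Literature.NumberTheory.Automorphic.SL2Rel.mul_apply_two,
        Literature.NumberTheory.Automorphic.SL2Rel.mul_apply_two,
        Literature.NumberTheory.Automorphic.SL2Rel.mul_apply_two, v00, v01, g00, g10, g01, g11, u01, u11, hu]
      linear_combination (-(b : Away t)) * hTT'
    · show (0 : Away t) = (lowerUnip v * G * upperUnip u) 1 0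
      rw [Literature.NumberTheory.Automorphic.SL2Rel.mul_apply_two,
        Literature.NumberTheory.Automorphic.SL2Rel.mul_apply_two,
        Literature.NumberTheory.Automorphic.SL2Rel.mul_apply_two, v10, v11, g00, g10, g01, g11, u00, u10, hv]
      linear_combination ((L' : Away t)) * hTT'
    · show T' = (lowerUnip v * G * upperUnip u) 1 1
      rw [Literature.NumberTheory.Automorphic.SL2Rel.mul_apply_two,
        Literature.NumberTheory.Automorphic.SL2Rel.mul_apply_two,
        Literature.NumberTheory.Automorphic.SL2Rel.mul_apply_two, v10, v11, g00, g10, g01, g11, u01, u11, hv, hu]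
      linear_combination ((L' : Away t) * b * T' + d) * hTT' - T' * hdb'
  rw [key]
  exact H.mul_mem (H.mul_mem (hV _) hγ₀) (hU _)


/-- `−1 = ι(−1) ∈ ι Γ₀(L')` (plumbing). [folklore] -/
theorem negOne_mem_gamma0Image (L' : ℕ) : (negOne : SL(2, Away t)) ∈ gamma0Image t L' := by
  refine ⟨⟨!![-1, 0; 0, -1], by rw [Matrix.det_fin_two_of]; ring⟩,
    mem_Gamma0_of_apply_one_zero_eq_zero L' _ rfl, ?_⟩
  ext i j
  fin_cases i <;> fin_cases j <;> simp [negOne]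

/-- **Diagonal elements `diag(±t^m, ∓…)` lie in `H`** once `diag(t,1/t), −1 ∈ H` — induction on `m`. [folklore] -/
theorem diag_mem_of_pow (hP : diagP t ∈ H) (hneg : (negOne : SL(2, Away t)) ∈ H) :
    ∀ (m : ℕ) (D : SL(2, Away t)), D 0 1 = 0 → D 1 0 = 0 →
      (D 0 0 = (algebraMap ℤ (Away t) (t : ℤ)) ^ m ∨ D 0 0 = -((algebraMap ℤ (Away t) (t : ℤ)) ^ m)) → D ∈ H := by
  set T : Away t := algebraMap ℤ (Away t) (t : ℤ) with hT
  set T' : Away t := IsLocalization.Away.invSelf (t : ℤ) with hT'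
  have hTT' : T * T' = 1 := IsLocalization.Away.mul_invSelf (S := Away t) (t : ℤ)
  intro m
  induction m with
  | zero =>
    intro D h01 h10 h00
    have hdet := Matrix.SpecialLinearGroup.det_coe D
    rw [Matrix.det_fin_two, h01, zero_mul, sub_zero] at hdet
    rw [pow_zero] at h00
    rcases h00 with h | h
    · have h11 : D 1 1 = 1 := by rw [h, one_mul] at hdet; exact hdet
      have : D = 1 := by
        ext i j; fin_cases i <;> fin_cases j <;> simp [h, h01, h10, h11]
      rw [this]; exact H.one_mem
    · have h11 : D 1 1 = -1 := by
        rw [h] at hdet; linear_combination -hdet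
      have : D = negOne := by
        ext i j; fin_cases i <;> fin_cases j <;> simp [negOne, h, h01, h10, h11]
      rw [this]; exact hneg
  | succ m ih =>
    intro D h01 h10 h00
    -- `D = diagP · D'` with `D' = diagP⁻¹ D` diagonal of exponent `m`
    have hD' : (diagP t)⁻¹ * D ∈ H := by
      apply ih
      · rw [Literature.NumberTheory.Automorphic.SL2Rel.mul_apply_two]
        simp [Matrix.SpecialLinearGroup.coe_inv, Matrix.adjugate_fin_two, diagP, h01]
      · rw [Literature.NumberTheory.Automorphic.SL2Rel.mul_apply_two]
        simp [Matrix.SpecialLinearGroup.coe_inv, Matrix.adjugate_fin_two, diagP, h10]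
      · have e : ((diagP t)⁻¹ * D) 0 0 = T' * D 0 0 := by
          rw [Literature.NumberTheory.Automorphic.SL2Rel.mul_apply_two]
          simp [Matrix.SpecialLinearGroup.coe_inv, Matrix.adjugate_fin_two, diagP, h10, ← hT']
        rw [e]
        rcases h00 with h | h
        · left; rw [h, pow_succ]; linear_combination T ^ m * hTT'
        · right; rw [h, pow_succ]; linear_combination (-(T ^ m)) * hTT'
    have : D = diagP t * ((diagP t)⁻¹ * D) := by group
    rw [this]
    exact H.mul_mem hP hD'

/-- **All diagonal elements `diag(±t^m t^{-e}, …)` lie in `H`** — induction on `e` on top of `diag_mem_of_pow`. [folklore] -/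
theorem diag_mem_of_pow_pow (hP : diagP t ∈ H) (hneg : (negOne : SL(2, Away t)) ∈ H) :
    ∀ (e m : ℕ) (D : SL(2, Away t)), D 0 1 = 0 → D 1 0 = 0 →
      (D 0 0 = (algebraMap ℤ (Away t) (t : ℤ)) ^ m * (IsLocalization.Away.invSelf (t : ℤ)) ^ e ∨
        D 0 0 = -((algebraMap ℤ (Away t) (t : ℤ)) ^ m * (IsLocalization.Away.invSelf (t : ℤ)) ^ e)) → D ∈ H := by
  set T : Away t := algebraMap ℤ (Away t) (t : ℤ) with hT
  set T' : Away t := IsLocalization.Away.invSelf (t : ℤ) with hT'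
  have hTT' : T * T' = 1 := IsLocalization.Away.mul_invSelf (S := Away t) (t : ℤ)
  intro e
  induction e with
  | zero =>
    intro m D h01 h10 h00
    rw [pow_zero, mul_one] at h00
    exact diag_mem_of_pow H hP hneg m D h01 h10 h00
  | succ e ih =>
    intro m D h01 h10 h00
    -- `D = diagP⁻¹ · D'` with `D' = diagP D` of exponents `(m, e)`
    have hD' : diagP t * D ∈ H := by
      apply ih m
      · rw [Literature.NumberTheory.Automorphic.SL2Rel.mul_apply_two]; simp [diagP, h01]
      · rw [Literature.NumberTheory.Automorphic.SL2Rel.mul_apply_two]; simp [diagP, h10]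
      · have e' : (diagP t * D) 0 0 = T * D 0 0 := by
          rw [Literature.NumberTheory.Automorphic.SL2Rel.mul_apply_two]; simp [diagP, h10, ← hT]
        rw [e']
        rcases h00 with h | h
        · left; rw [h, pow_succ]; linear_combination T ^ m * T' ^ e * hTT'
        · right; rw [h, pow_succ]; linear_combination (-(T ^ m * T' ^ e)) * hTT'
    have : D = (diagP t)⁻¹ * (diagP t * D) := by group
    rw [this]
    exact H.mul_mem (H.inv_mem hP) hD'

/-- **`B⁺ ≤ H`** once `diag(t,1/t), −1 ∈ H` and `U⁺(ℤ[1/t]) ≤ H`: an upper-triangular `b` is `diag(u, u⁻¹)·(1 x; 0 1)` and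
the units of `ℤ[1/t]` are `±t^ℤ` (bsd-f3-mu's `natAbs_eq_pow_of_isUnit_intCast`). [folklore] -/
theorem upperB_le_of_mem (htp : t.Prime) (hP : diagP t ∈ H) (hneg : (negOne : SL(2, Away t)) ∈ H)
    (hU : ∀ x : Away t, upperUnip x ∈ H) : upperB t ≤ H := by
  intro b hb
  have hb10 : b 1 0 = 0 := hb
  have hdet := Matrix.SpecialLinearGroup.det_coe b
  rw [Matrix.det_fin_two, hb10, mul_zero, sub_zero] at hdet
  -- `b = D · U⁺(b₁₁ b₀₁)` with `D = diag(b₀₀, b₁₁)`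
  let D : SL(2, Away t) := ⟨!![b 0 0, 0; 0, b 1 1], by rw [Matrix.det_fin_two_of]; linear_combination hdet⟩
  have hbD : b = D * upperUnip (b 1 1 * b 0 1) := by
    ext i j
    fin_cases i <;> fin_cases j <;>
      simp [D, upperUnip, Matrix.mul_apply, Fin.sum_univ_two, hb10]
    linear_combination (-(b 0 1)) * hdet
  -- the unit `b₀₀ = ± t^m / t^e`
  obtain ⟨e, a, _, ha, -⟩ := exists_common_denom (p := t) (b 0 0) 0
  have hunit : IsUnit ((a : ℤ) : Away t) := by
    rw [← ha]
    exact (isUnit_iff_exists_inv.mpr ⟨b 1 1, hdet⟩).mul (isUnit_natCast_pow e)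
  obtain ⟨m, hm⟩ := natAbs_eq_pow_of_isUnit_intCast htp hunit
  set T : Away t := algebraMap ℤ (Away t) (t : ℤ) with hT
  set T' : Away t := IsLocalization.Away.invSelf (t : ℤ) with hT'
  have hTT' : T * T' = 1 := IsLocalization.Away.mul_invSelf (S := Away t) (t : ℤ)
  have hTt : T = (t : Away t) := by rw [hT, map_natCast]
  have h00 : b 0 0 = T ^ m * T' ^ e ∨ b 0 0 = -(T ^ m * T' ^ e) := by
    have hinv : ((t : Away t) ^ e) * T' ^ e = 1 := by rw [← hTt, ← mul_pow, hTT', one_pow]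
    have hb00 : b 0 0 = (a : Away t) * T' ^ e := by
      rw [← ha, mul_assoc, hinv, mul_one]
    rcases Int.natAbs_eq a with h | h
    · left
      rw [hb00, h, hm]; push_cast; rw [hTt]
    · right
      rw [hb00, h, hm]; push_cast; rw [hTt]; ring
  have hD : D ∈ H := diag_mem_of_pow_pow H hP hneg e m D rfl rfl h00
  rw [hbD]
  exact H.mul_mem hD (hU _)

end Borel


/-! ### LEMMA G assembled -/

section Main

variable {t n : ℕ} [NeZero t] (H : Subgroup SL(2, Away t))

/-- **LEMMA G (E-es-31, MEMO-es §23.1): the S-arithmetic closure.**  Let `t` be prime, `n ≥ 1`, `L'` with `t ∤ L'`,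
`k ≥ 0`.  If a subgroup `H ≤ SL₂(ℤ[1/t])` contains `ι Γ₀(t^k L')` and is stable under the shifts
`(α, β; γ, δ) ↦ (α, t^n β; t^{-n} γ, δ)` (`hS`) and `(α, β; γ, δ) ↦ (α, t^{-n} β; t^n γ, δ)` (`hS'`) — the conjugations
by `diag(t,1)^{±n}` — then `H ⊇ Δ_t(L') = {g ∈ SL₂(ℤ[1/t]) : γ ∈ L'ℤ[1/t]}` (bsd-f3-mu's `Delta t L'`).
Proof: descent `ι Γ₀(L') ≤ H` (`gamma0Image_le_of_shiftStable_pow`), unipotents `U⁺(ℤ[1/t])`, `U⁻(L'ℤ[1/t])`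
(`upperUnip_mem_of_shiftStable`, `lowerUnip_mem_of_shiftStable`), `diag(t,1/t)` (`diagP_mem_of_unipotents`), `B⁺`
(`upperB_le_of_mem`), and `Δ_t(L') = ι Γ₀(L')·B⁺` (`deltaEqGamma0MulUpper`, bsd-f3-mu THEOREM B kit, BY NAME).  Use
(MEMO-es §23): the invariance group of the symbol of a shift-invariant cocycle contains `Γ₀(L)` and `A^{±n}`, hence
`Δ_t(L')`, so the congruence subgroup property of `SL₂(ℤ[1/t])` (tree theorem) applies to the glued homomorphism. [folklore] -/
theorem delta_le_of_gamma0Image_le_of_shiftStable (htp : t.Prime) (hn : 1 ≤ n) {L' : ℕ} (hL' : ¬ t ∣ L') (k : ℕ)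
    (hΓ : gamma0Image t (t ^ k * L') ≤ H)
    (hS : ∀ g ∈ H, ∀ g' : SL(2, Away t), g' 0 0 = g 0 0 → g' 0 1 = (t : Away t) ^ n * g 0 1 →
      (t : Away t) ^ n * g' 1 0 = g 1 0 → g' 1 1 = g 1 1 → g' ∈ H)
    (hS' : ∀ g ∈ H, ∀ g' : SL(2, Away t), g' 0 0 = g 0 0 → (t : Away t) ^ n * g' 0 1 = g 0 1 →
      g' 1 0 = (t : Away t) ^ n * g 1 0 → g' 1 1 = g 1 1 → g' ∈ H) :
    Delta t L' ≤ H := by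
  have hΓ' : gamma0Image t L' ≤ H := gamma0Image_le_of_shiftStable_pow H htp hn k hΓ hS
  have hU : ∀ x : Away t, upperUnip x ∈ H := upperUnip_mem_of_shiftStable H hn hΓ' hS'
  have hV : ∀ y : Away t, lowerUnip ((L' : Away t) * y) ∈ H := lowerUnip_mem_of_shiftStable H hn hΓ' hS
  have hP : diagP t ∈ H := diagP_mem_of_unipotents H htp hL' hΓ' hU hV
  have hneg : (negOne : SL(2, Away t)) ∈ H := hΓ' (negOne_mem_gamma0Image L')
  have hB : upperB t ≤ H := upperB_le_of_mem H htp hP hneg hU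
  intro g hg
  obtain ⟨γ, hγ, b, hb, rfl⟩ := deltaEqGamma0MulUpper htp hL' g hg
  exact H.mul_mem (hΓ' ⟨γ, hγ, rfl⟩) (hB hb)

end Main

end Summit.BirchSwinnertonDyer.BirchSwinnertonDyer.Theorems.ManinLocalTwoThree
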